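import Mathlib.Data.Nat.Choose.Basic
import Mathlib.Data.Nat.Factorial.Basic
import Mathlib.Data.Real.Basic
import Mathlib.Tactic
import HarnessLib

/-!
# A lower bound on a ratio of binomial coefficients (Duminil-Copin–Hammond 2013, Lemma 3.8)

Source: H. Duminil-Copin, A. Hammond, *Self-avoiding walk is sub-ballistic*, Comm. Math. Phys.
**324** (2013) 401–423, arXiv:1205.0401, §3, Lemma 3.8 (held LaTeX copy `paper:arxiv-1205.0401`,
chunk p0010:L53–L54). AS PRINTED: "We omit the proof of the following easy fact. **Lemma 3.8.**
Suppose that `n₁ ≥ n₂ ≥ m`. Then `C(n₁,m)/C(n₂,m) ≥ ((n₁ − m)/n₂)^m`." It is the entropy bound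
used in Case 3 of the proof of Proposition 3.2 (the zigzag-unfolding comparison), i.e. in the crux
`K1` of the lane programme «DCH-1.1» (Duminil-Copin–Hammond Theorem 1.1 as a theorem).

Proof (the omitted one): `C(n₁,m)/C(n₂,m) = Π_{i<m} (n₁ − i)/(n₂ − i)` (descending factorials)
and each factor is `≥ (n₁ − m)/n₂`. We prove the cleared-denominator form over `ℕ` by induction on
`m` (`Nat.descFactorial_succ`) and divide.

Contents (namespace `Literature.Combinatorics`): `descFactorial_ratio_lower_nat` (the `ℕ`
inequality `(n₁ − m)^m · n₂^{(m)} ≤ n₂^m · n₁^{(m)}`), `DuminilCopinHammond2013_lemma38` (as printed,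
real division). No definitions, no facts.
-/

namespace Literature.Combinatorics

open Nat

/-- Cleared-denominator form of Lemma 3.8 over `ℕ`: for `m ≤ n₂ ≤ n₁`,
`(n₁ − m)^m · n₂.descFactorial m ≤ n₂^m · n₁.descFactorial m` (each of the `m` factors
`n₂ − i` of `n₂^{(m)}` is `≤ n₂`, each factor `n₁ − i` of `n₁^{(m)}` is `≥ n₁ − m`).
[cite: DuminilCopinHammond2013, Lemma 3.8] -/
theorem descFactorial_ratio_lower_nat {n₁ n₂ m : ℕ} (h₁ : n₂ ≤ n₁) (h₂ : m ≤ n₂) :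
    (n₁ - m) ^ m * n₂.descFactorial m ≤ n₂ ^ m * n₁.descFactorial m := by
  induction m with
  | zero => simp
  | succ m ih =>
    have ih' := ih (by omega)
    rw [Nat.descFactorial_succ, Nat.descFactorial_succ, pow_succ, pow_succ]
    -- `(n₁-m-1)^m (n₁-m-1) · ((n₂-m) D₂) ≤ (n₂^m n₂) · ((n₁-m) D₁)`
    have h3 : (n₁ - (m + 1)) ^ m ≤ (n₁ - m) ^ m := Nat.pow_le_pow_left (by omega) m
    calc (n₁ - (m + 1)) ^ m * (n₁ - (m + 1)) * ((n₂ - m) * n₂.descFactorial m)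
        = ((n₁ - (m + 1)) ^ m * n₂.descFactorial m) * ((n₁ - (m + 1)) * (n₂ - m)) := by ring
      _ ≤ ((n₁ - m) ^ m * n₂.descFactorial m) * ((n₁ - m) * n₂) := by
          apply Nat.mul_le_mul
          · exact Nat.mul_le_mul_right _ h3
          · exact Nat.mul_le_mul (by omega) (by omega)
      _ ≤ (n₂ ^ m * n₁.descFactorial m) * ((n₁ - m) * n₂) := Nat.mul_le_mul_right _ ih'
      _ = n₂ ^ m * n₂ * ((n₁ - m) * n₁.descFactorial m) := by ring

/-- **Duminil-Copin–Hammond 2013, Lemma 3.8** (AS PRINTED; proof omitted in the source): "Suppose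
that `n₁ ≥ n₂ ≥ m`. Then `C(n₁,m) / C(n₂,m) ≥ ((n₁ − m)/n₂)^m`." Real division; for `n₂ = 0`
(hence `m = 0`) both sides are `1`. [cite: DuminilCopinHammond2013, Lemma 3.8] -/
theorem DuminilCopinHammond2013_lemma38 {n₁ n₂ m : ℕ} (h₁ : n₂ ≤ n₁) (h₂ : m ≤ n₂) :
    (((n₁ : ℝ) - m) / n₂) ^ m ≤ (n₁.choose m : ℝ) / (n₂.choose m : ℝ) := by
  rcases Nat.eq_zero_or_pos n₂ with h0 | hpos
  · subst h0
    have hm : m = 0 := by omega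
    subst hm
    simp
  have hn₂ : (0 : ℝ) < n₂ := by exact_mod_cast hpos
  have hD₂ : (0 : ℝ) < (n₂.descFactorial m : ℝ) := by
    have h : n₂.descFactorial m ≠ 0 := fun h0 =>
      absurd (Nat.descFactorial_eq_zero_iff_lt.1 h0) (not_lt.2 h₂)
    exact_mod_cast Nat.pos_of_ne_zero h
  have hnat := descFactorial_ratio_lower_nat h₁ h₂
  have hreal : (((n₁ : ℝ) - m) ^ m) * (n₂.descFactorial m : ℝ) ≤
      ((n₂ : ℝ) ^ m) * (n₁.descFactorial m : ℝ) := by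
    have hc : ((n₁ - m : ℕ) : ℝ) = (n₁ : ℝ) - m := by
      rw [Nat.cast_sub (h₂.trans h₁)]
    have := (Nat.cast_le (α := ℝ)).2 hnat
    push_cast at this
    rw [hc] at this
    exact this
  -- `C(n,m) = n^{(m)} / m!`
  have hchoose : ∀ n : ℕ, (n.choose m : ℝ) = (n.descFactorial m : ℝ) / (m.factorial : ℝ) := by
    intro n
    have hf : (m.factorial : ℝ) ≠ 0 := by exact_mod_cast (Nat.factorial_pos m).ne'
    rw [eq_div_iff hf]
    exact_mod_cast (by rw [Nat.descFactorial_eq_factorial_mul_choose]; ring :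
      n.choose m * m.factorial = n.descFactorial m)
  rw [hchoose n₁, hchoose n₂, div_div_div_cancel_right₀ (by exact_mod_cast (Nat.factorial_pos m).ne'),
    div_pow, div_le_div_iff₀ (pow_pos hn₂ m) hD₂]
  linarith [hreal]

end Literature.Combinatorics
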